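import Summits.Ventures.PercRepro.Night2TwoOneAssemblyW

/-!
# PercRepro — the cell `(2, 1)` with two fat closures: the capacity floors by profile (night-2, gen 28)

The floors `vTwoOne n i j` of the basis pairs' targets in the two-fat-closure cell (spread regime): `1` at the top
levels `i + j ≥ n − 2`, `97/108` at `i + j = n − 3`, `13/27` at `(i ≥ 4, j = 4)`, `2/9` at `(3, 4)`, `19/216` at
`(i ≥ 4, j = 3)`, `0` elsewhere — proved to hold in `Night2TwoOneFloorsB`, summed in `Night2TwoOneKernel`.
-/

namespace PercRepro.Shadow

/-- The capacity floors of the two-fat-closure cell by profile `(i, j)` along the plane at `|V| = n`. -/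
def vTwoOne (n i j : ℕ) : ℚ :=
  if n ≤ i + j + 2 then 1
  else if i + j + 3 = n then 97 / 108
  else if j = 4 then (if 4 ≤ i then 13 / 27 else 2 / 9)
  else if j = 3 then (if 4 ≤ i then 19 / 216 else 0)
  else 0

/-- The floors are nonnegative. -/
theorem vTwoOne_nonneg (n i j : ℕ) : 0 ≤ vTwoOne n i j := by
  unfold vTwoOne
  split_ifs <;> norm_num

end PercRepro.Shadow
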